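import Summits.CriticalPhenomena.PercolationContinuityZ3.Theorems.Transplant.PlanarSkeletonFrmFromDefs
import Summits.CriticalPhenomena.PercolationContinuityZ3.Theorems.Transplant.SkelFrmFromBChoiceReadNums
import Summits.CriticalPhenomena.PercolationContinuityZ3.Theorems.Transplant.SkelFrmBChoiceReadNums
import Summits.CriticalPhenomena.PercolationContinuityZ3.Theorems.Transplant.SkelFrmFromBChoiceRadii
import Summits.CriticalPhenomena.PercolationContinuityZ3.Theorems.Transplant.SkelFrmBChoiceRadii
import HarnessLib
import Summits.CriticalPhenomena.PercolationContinuityZ3.Theorems.Transplant.SkelFrmBChoiceDepth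
/-!
# U-WAVE PORT (RULING D-U, lead g21 2026-08-26; WAVE-U-MANIFEST v3.0 row «SkelFrmBChoiceDepth» ↦ «SkelFrmFromBChoiceDepth») of the tree module
# `Transplant/SkelFrmBChoiceDepth` onto the carrier `PlanarSkeletonFrmFrom` (frames only, cylinders connected from width `ℓ₀` on)

ORIGINAL TITLE: N2 (frames-only node `SamePDropOfSkeletonFrm₁`, OPEN) — (ζ″) ledger, THE (C) DEPTH ROW `hRD` (x-corridor) at the tuple of record: the prism box's total reach

builds on p205010 (kernel theorem, internal audit signed; external expert review pending) — nothing in this file uses p205010; NOTHING is claimed about the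
OPEN node U `SamePDropOfSkeletonFrmFrom₁` (nor U_s / the end state).  Lane `prim-bschramm`, seat `prim-hp-8 gen 53 (U-wave port pen, family P-hp8; tool of record = p3-g26 port_u.py)`; helper file
(`--supports stmt-CriticalPhenomena-4575 --as helper`).  PORT RULES r1–r4 of RULING D-U: declaration order and proof texts are those of the original,
byte-identical except (i) the carrier token `PlanarSkeletonFrm ↦ PlanarSkeletonFrmFrom` (binders, `namespace`/`end` lines, qualified names of twinned
declarations), (ii) carrier-FREE declarations of the original (φ-level `Skelφ…` blocks and namespace-only arithmetic residents) are NOT re-declared —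
this file imports the original and `export`s the twin-free residents (POLICY T / treatment (m1)); residents whose statement mentions a twinned
constant are copied, (iii) every carrier-binding declaration keeps its explicit binder `(Φ : PlanarSkeletonFrmFrom G)` in its own signature (r2).  Docstrings and citations are the original's.  Manifest row idx 80 (level 12; flags verbatim|DEF-ROW); filed by the hp-8 lineage under RULING M-11 (family P-hp8).
-/

open scoped Classical

noncomputable section

namespace Summit.CriticalPhenomena.PercolationContinuityZ3.Theorems.Transplant

namespace PlanarSkeletonFrmFrom

namespace NegB

open Literature.Probability.Percolation Literature.Probability.LatticeModels SimpleGraph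
open SkelConc (Consts)
open BoxProdZ2 (nQ)
open Skelφ (kgSL kgZ₀ kgZ₁ kgM₁ kgM₂ kgWm₂ kgWp₂)
open Neg

section Depth

variable (κ : Consts) {V : Type} [DecidableEq V] [Countable V] {G : SimpleGraph V} [G.LocallyFinite] (Φ : PlanarSkeletonFrmFrom G) (t : V) (p : unitInterval)
  (D : Skelφ.StepI.DataNS V) (g f mk : ℕ) (c : Fin 2 → ℕ) (ex mx : GSlot) (q : unitInterval)

/-- **The depth budget of record** `ZD := 13·(20K·n_L + 5·n_L + 18·⌊sL⌋₊)` (a natural number). [this work] -/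
def ZD (κ : Consts) {V : Type} [DecidableEq V] [Countable V] {G : SimpleGraph V} [G.LocallyFinite] (Φ : PlanarSkeletonFrmFrom G) (t : V) (p : unitInterval) (D : Skelφ.StepI.DataNS V) (g : ℕ) (f : ℕ) : ℕ := 13 * (20 * Neg.K κ * nL κ Φ t p D g f + 5 * nL κ Φ t p D g f + 18 * (kgSL (nL κ Φ t p D g f) (ℓL κ Φ t p D g f) (hL κ Φ t p D g f)).toNat)

/-- `13·((N+1)n_L + Z₀ + Z₁) ≤ ZD` at the tuple of record. [this work] -/
theorem reach_le_ZD (κ : Consts) {V : Type} [DecidableEq V] [Countable V] {G : SimpleGraph V} [G.LocallyFinite] (Φ : PlanarSkeletonFrmFrom G) (t : V) (p : unitInterval) (D : Skelφ.StepI.DataNS V) (g : ℕ) (f : ℕ) (mk : ℕ) (hN : EqNumL κ Φ t p D g f) (hg : gFloorKG κ Φ t p D mk ≤ g) (hg2 : 40 * Neg.K κ * KS0.R'0 κ Φ t p D mk ≤ g) :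
    13 * ((((kgNv0 κ Φ t p D g f mk (qxQ κ Φ t p D g f) (WxQ κ Φ t p D g f) : ℕ) : ℤ) + 1) * (nL κ Φ t p D g f : ℤ) +
      kgZ₀ (nL κ Φ t p D g f) (vL κ Φ t p D g f) (kgR κ Φ t p D mk) 0 (kgq κ Φ t p D g f (qxQ κ Φ t p D g f))
        (kgNv0 κ Φ t p D g f mk (qxQ κ Φ t p D g f) (WxQ κ Φ t p D g f))
        (kgM₁ (nL κ Φ t p D g f) (ℓL κ Φ t p D g f) (hL κ Φ t p D g f) (kgR κ Φ t p D mk) 0 (kgW κ Φ t p D g f (WxQ κ Φ t p D g f))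
          (kgNv0 κ Φ t p D g f mk (qxQ κ Φ t p D g f) (WxQ κ Φ t p D g f)))
        (kgM₂ (nL κ Φ t p D g f) (ℓL κ Φ t p D g f) (hL κ Φ t p D g f) (vL κ Φ t p D g f) (kgR κ Φ t p D mk) 0
          (kgq κ Φ t p D g f (qxQ κ Φ t p D g f)) (kgW κ Φ t p D g f (WxQ κ Φ t p D g f)) (kgNv0 κ Φ t p D g f mk (qxQ κ Φ t p D g f) (WxQ κ Φ t p D g f))) +
      kgZ₁ (nL κ Φ t p D g f) (ℓL κ Φ t p D g f) (hL κ Φ t p D g f) (kgR κ Φ t p D mk) 0 (kgW κ Φ t p D g f (WxQ κ Φ t p D g f))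
        (kgNv0 κ Φ t p D g f mk (qxQ κ Φ t p D g f) (WxQ κ Φ t p D g f))
        (kgM₁ (nL κ Φ t p D g f) (ℓL κ Φ t p D g f) (hL κ Φ t p D g f) (kgR κ Φ t p D mk) 0 (kgW κ Φ t p D g f (WxQ κ Φ t p D g f))
          (kgNv0 κ Φ t p D g f mk (qxQ κ Φ t p D g f) (WxQ κ Φ t p D g f)))
        (kgWm₂ (nL κ Φ t p D g f) (ℓL κ Φ t p D g f) (hL κ Φ t p D g f) (kgR κ Φ t p D mk) 0 (kgW κ Φ t p D g f (WxQ κ Φ t p D g f))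
          (kgNv0 κ Φ t p D g f mk (qxQ κ Φ t p D g f) (WxQ κ Φ t p D g f)))
        (kgWp₂ (nL κ Φ t p D g f) (ℓL κ Φ t p D g f) (hL κ Φ t p D g f) (kgR κ Φ t p D mk) 0 (kgW κ Φ t p D g f (WxQ κ Φ t p D g f))
          (kgNv0 κ Φ t p D g f mk (qxQ κ Φ t p D g f) (WxQ κ Φ t p D g f)))
        (kgM₂ (nL κ Φ t p D g f) (ℓL κ Φ t p D g f) (hL κ Φ t p D g f) (vL κ Φ t p D g f) (kgR κ Φ t p D mk) 0
          (kgq κ Φ t p D g f (qxQ κ Φ t p D g f)) (kgW κ Φ t p D g f (WxQ κ Φ t p D g f)) (kgNv0 κ Φ t p D g f mk (qxQ κ Φ t p D g f) (WxQ κ Φ t p D g f))))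
      ≤ ((ZD κ Φ t p D g f : ℕ) : ℤ) := by
  obtain ⟨-, hfar⟩ := Z₀Q_le κ Φ t p D g f mk hN hg hg2
  have hZ₁ := Z₁Q_le κ Φ t p D g f mk hN hg hg2
  obtain ⟨-, -, hbig, -, -, -⟩ := valsQ_floor κ Φ t p D g f mk hN hg hg2
  have hs0 : 0 ≤ kgSL (nL κ Φ t p D g f) (ℓL κ Φ t p D g f) (hL κ Φ t p D g f) := by linarith
  unfold ZD
  push_cast
  rw [Int.toNat_of_nonneg hs0]
  linarith

/-- **THE DEPTH ROW `hRD` at the tuple of record**: `(cOffS·‖y‖₁ + 1) + 13·((N+1)n_L + Z₀ + Z₁) ≤ rQ a y` for the schedule of record, under the residual floor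
`ZD + 1 ≤ ex` and `‖y‖₁ ≤ nQ a y`. [this work] -/
theorem hRD_Q (κ : Consts) {V : Type} [DecidableEq V] [Countable V] {G : SimpleGraph V} [G.LocallyFinite] (Φ : PlanarSkeletonFrmFrom G) (t : V) (p : unitInterval) (D : Skelφ.StepI.DataNS V) (g : ℕ) (f : ℕ) (mk : ℕ) (c : Fin 2 → ℕ) (ex : GSlot) (mx : GSlot) (q : unitInterval) (hN : EqNumL κ Φ t p D g f) (hg : gFloorKG κ Φ t p D mk ≤ g) (hg2 : 40 * Neg.K κ * KS0.R'0 κ Φ t p D mk ≤ g)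
    (hexD : ZD κ Φ t p D g f + 1 ≤ ex κ Φ t p D g f) (a : ℕ) (y : Site 2) (hy : (y 0).natAbs + (y 1).natAbs ≤ nQ a y) :
    ((cOffS κ Φ t p D g f * ((y 0).natAbs + (y 1).natAbs) + 1 : ℕ) : ℤ) +
      13 * ((((kgNv0 κ Φ t p D g f mk (qxQ κ Φ t p D g f) (WxQ κ Φ t p D g f) : ℕ) : ℤ) + 1) * (nL κ Φ t p D g f : ℤ) +
      kgZ₀ (nL κ Φ t p D g f) (vL κ Φ t p D g f) (kgR κ Φ t p D mk) 0 (kgq κ Φ t p D g f (qxQ κ Φ t p D g f))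
        (kgNv0 κ Φ t p D g f mk (qxQ κ Φ t p D g f) (WxQ κ Φ t p D g f))
        (kgM₁ (nL κ Φ t p D g f) (ℓL κ Φ t p D g f) (hL κ Φ t p D g f) (kgR κ Φ t p D mk) 0 (kgW κ Φ t p D g f (WxQ κ Φ t p D g f))
          (kgNv0 κ Φ t p D g f mk (qxQ κ Φ t p D g f) (WxQ κ Φ t p D g f)))
        (kgM₂ (nL κ Φ t p D g f) (ℓL κ Φ t p D g f) (hL κ Φ t p D g f) (vL κ Φ t p D g f) (kgR κ Φ t p D mk) 0
          (kgq κ Φ t p D g f (qxQ κ Φ t p D g f)) (kgW κ Φ t p D g f (WxQ κ Φ t p D g f)) (kgNv0 κ Φ t p D g f mk (qxQ κ Φ t p D g f) (WxQ κ Φ t p D g f))) +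
      kgZ₁ (nL κ Φ t p D g f) (ℓL κ Φ t p D g f) (hL κ Φ t p D g f) (kgR κ Φ t p D mk) 0 (kgW κ Φ t p D g f (WxQ κ Φ t p D g f))
        (kgNv0 κ Φ t p D g f mk (qxQ κ Φ t p D g f) (WxQ κ Φ t p D g f))
        (kgM₁ (nL κ Φ t p D g f) (ℓL κ Φ t p D g f) (hL κ Φ t p D g f) (kgR κ Φ t p D mk) 0 (kgW κ Φ t p D g f (WxQ κ Φ t p D g f))
          (kgNv0 κ Φ t p D g f mk (qxQ κ Φ t p D g f) (WxQ κ Φ t p D g f)))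
        (kgWm₂ (nL κ Φ t p D g f) (ℓL κ Φ t p D g f) (hL κ Φ t p D g f) (kgR κ Φ t p D mk) 0 (kgW κ Φ t p D g f (WxQ κ Φ t p D g f))
          (kgNv0 κ Φ t p D g f mk (qxQ κ Φ t p D g f) (WxQ κ Φ t p D g f)))
        (kgWp₂ (nL κ Φ t p D g f) (ℓL κ Φ t p D g f) (hL κ Φ t p D g f) (kgR κ Φ t p D mk) 0 (kgW κ Φ t p D g f (WxQ κ Φ t p D g f))
          (kgNv0 κ Φ t p D g f mk (qxQ κ Φ t p D g f) (WxQ κ Φ t p D g f)))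
        (kgM₂ (nL κ Φ t p D g f) (ℓL κ Φ t p D g f) (hL κ Φ t p D g f) (vL κ Φ t p D g f) (kgR κ Φ t p D mk) 0
          (kgq κ Φ t p D g f (qxQ κ Φ t p D g f)) (kgW κ Φ t p D g f (WxQ κ Φ t p D g f)) (kgNv0 κ Φ t p D g f mk (qxQ κ Φ t p D g f) (WxQ κ Φ t p D g f))))
      ≤ (((schedOfS κ Φ t p D g f c (SUS ex mx κ Φ t p D g f q)).rQ a y : ℕ) : ℤ) := by
  have h1 := depth_row_US κ Φ t p D g f c ex mx q a y hy hexD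
  have h2 := reach_le_ZD κ Φ t p D g f mk hN hg hg2
  have h3 : ((cOffS κ Φ t p D g f * ((y 0).natAbs + (y 1).natAbs) + 1 + ZD κ Φ t p D g f : ℕ) : ℤ) ≤
      (((schedOfS κ Φ t p D g f c (SUS ex mx κ Φ t p D g f q)).rQ a y : ℕ) : ℤ) := by exact_mod_cast h1
  push_cast at h3 ⊢
  linarith

end Depth

end NegB

end PlanarSkeletonFrmFrom

end Summit.CriticalPhenomena.PercolationContinuityZ3.Theorems.Transplant

end
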